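import Literature.NumberTheory.ConnesConsani2021.WeilPropertyP
import Summits.RiemannHypothesis.RiemannHypothesis.Theorems.SoloInformedPoleFree
import Summits.RiemannHypothesis.RiemannHypothesis.Theorems.WeilPositivityLogTwo
import Summits.RiemannHypothesis.Statement
import HarnessLib

/-!
# Connes's property `P(n)`: the printed equivalence `(∀ n, P(n)) ↔ RH` DISCHARGED, and `P(4)`

Cell `rh-explicit` (HOME `run/shared/lean/pub/rh-explicit/`), seat cc-s2-4 (`HOME/cc-s2-4/CC4-LEAN.md` §2).
Companion of `Literature/NumberTheory/ConnesConsani2021/WeilPropertyP.lean`, which types A. Connes,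
arXiv:2602.04022 (2026) §4.1 "property `P(n)`, involving only the Euler factors for primes smaller than `n`,
whose validity for all `n` is equivalent to RH" (`weilPropertyP n`; `P(2)`, `P(3)` proved there from the
tree's kernel certificates).  Here, with Summits-side theorems available:

* `riemannHypothesis_iff_forall_weilPropertyP`: the printed equivalence `RH ↔ ∀ n, P(n)`, PROVED — it is the
  pole-free form of Weil's criterion (`riemannHypothesis_iff_poleFree`, Bombieri 2000 Thms 1–2 run inside the
  dipole-stable class `ĝ(0) = ĝ(1) = 0`) combined with "every test function lives in some window"
  (`forall_weilPropertyP_iff_poleFree`).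
* `weilPropertyP_four`: `P(4)` (primes `2, 3` enter), from the tree's two-prime rung
  `weilPositivityOn_log_two : WeilPositivityOn (log 2)` (`(log 4)/2 = log 2`); hence `P(n)` for all `n ≤ 4`.
  `P(5) = ` positivity on `(log 5)/2 = 0.80471…` is NOT claimed (tree frontier `a = 4023/5000 = 0.8046`).

Honest framing: a typed reading of a printed survey statement and its discharge from theorems already in the
tree; the only new content is bookkeeping.  No RH claim.
-/

set_option linter.dupNamespace false  -- the mandated namespace repeats `RiemannHypothesis`

noncomputable section

open Set
open Literature.NumberTheory.LFunctions Literature.NumberTheory.ConnesConsani2021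

namespace Summit.RiemannHypothesis.RiemannHypothesis.Theorems.ConnesPropertyP

/-- **Connes 2026 §4.1 as printed, PROVED**: `RH ↔ ∀ n, P(n)` — "a property `P(n)`, involving only the
Euler factors for primes smaller than `n`, and whose validity for all `n` is equivalent to RH". [cite: Connes2026Letter, §4.1 p. 17 (chunk p0017 L15–18, L35–37); Bombieri2000Weil Thms. 1–2] -/
theorem riemannHypothesis_iff_forall_weilPropertyP : RiemannHypothesis ↔ ∀ n : ℕ, weilPropertyP n := by
  rw [forall_weilPropertyP_iff_poleFree]
  exact riemannHypothesis_iff_poleFree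

/-- The same for the summit statement `Summit.RiemannHypothesis`. [cite: Connes2026Letter, §4.1 p. 17] -/
theorem summit_iff_forall_weilPropertyP : _root_.Summit.RiemannHypothesis ↔ ∀ n : ℕ, weilPropertyP n :=
  _root_.Summit.RiemannHypothesis_iff.trans riemannHypothesis_iff_forall_weilPropertyP

/-- `(log 4)/2 = log 2`. [folklore] -/
theorem log_four_half : Real.log ((4 : ℕ) : ℝ) / 2 = Real.log 2 := by
  rw [show ((4 : ℕ) : ℝ) = 2 ^ 2 by norm_num, Real.log_pow]
  ring

/-- **`P(4)`** (the primes `2` and `3` enter; window `(log 4)/2 = log 2`): from the tree's two-prime rung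
`weilPositivityOn_log_two`. OPEN in print. [cite: Connes2026Letter, §4.1 p. 17 L15–18 (the property); certificate in tree] -/
theorem weilPropertyP_four : weilPropertyP 4 :=
  weilPropertyP_of_weilPositivityOn (by rw [log_four_half]; exact EvenWinsBeyondArch.weilPositivityOn_log_two)

/-- `P(n)` for every `n ≤ 4`. [folklore] -/
theorem weilPropertyP_of_le_four {n : ℕ} (hn : n ≤ 4) : weilPropertyP n :=
  weilPropertyP_four.mono hn

end Summit.RiemannHypothesis.RiemannHypothesis.Theorems.ConnesPropertyP

end
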